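import Summits.ResolutionOfSingularities.ResolutionOfSingularities.Theorems.WildQuotientsSummitReductionStubPairOrbitBlowupCentreLocalLemmas11
import Summits.ResolutionOfSingularities.ResolutionOfSingularities.Theorems.WildQuotientsSummitReductionStubPairOrbitBlowupCentreLocalLemmas
import HarnessLib

/-!
# `WildQuotients.SummitReduction` (stmt-ResolutionOfSingularities-16324), line `FramePerfect`:
# the level data of the fibre local ring at a point over the centre (input of the engine)
# (algebra of stub `stub_pair_orbitBlowupCentreLocal`, file 12)

Route `ResolutionOfSingularities/WildQuotients`, crux `SummitReduction`; helper file of stub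
`stub_pair_orbitBlowupCentreLocal` (C2: de Jong 1996, 3.4 Claim (ii) over the orbit centre, with
quasi-splitness upstairs, de Jong 1997, proof of Prop. 5.11 ¶1). File 6 gives, at every point `x'`
of the blown-up curve over the centre, `𝒪̂_{X₁,x'} ≅ T̂` for a local ring `T` of a chart
`Λ[x, y]/(xy - a₀)` at a prime `𝔔 ⊇ 𝔪_Λ`, compatibly with the base. The engine of file 9 compares
the local rings of the base changes `l' ⊗_l B` of the fibre local ring `B = 𝒪_{X₁,x'}/𝔪_y 𝒪_{X₁,x'}`
with those of `l' ⊗_l C`, `C` a local ring of the model `l[x, y]/(xy - ā)` over `l = κ(y)`, given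
level-bijective maps `B → R̂ ← C` into a common complete local ring. This file PROVES that input:

* `map_maximalIdeal_and_levelBijective_localCpl` — `C → Ĉ` for a Noetherian local ring;
* `exists_levelData_of_chart` (entry) — **from `E : 𝒪̂' ≅ T̂` to `g₁ : B → Ĉ`**, `C` the local ring of
  `l[x, y]/(xy - ā)` at a prime `𝔔_l` containing `x̄` (resp. `ȳ`) iff `𝔔` does: `g₁` is
  `B → B̂ ≅ (T/𝔪_Λ T)^` (file 4: completion commutes with quotients) `≅ Ĉ` (file 11: the special
  fibre of the chart is a local ring of the model), compatible with `l`, mapping `𝔪_B` onto `𝔪_Ĉ`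
  and level-bijective ("the special fibre intersected with this chart … is the spectrum of the ring
  `k[u, t₁']/(ut₁')`", de Jong 1996, p. 64).
-/

set_option linter.dupNamespace false

noncomputable section

open IsLocalRing
open Literature.AlgebraicGeometry.Resolution
open Literature.AlgebraicGeometry.Resolution.DeJong1996

namespace Summit.ResolutionOfSingularities.ResolutionOfSingularities.Theorems

universe u

/-! ## The completion of a Noetherian local ring: levels -/

section Cpl

/-- **`C → Ĉ` maps `𝔪_C` onto `𝔪_Ĉ` and has bijective levels `C/𝔪ⁿ → Ĉ/𝔪ⁿĈ`** (Noetherian local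
`C`; Stacks 05GG). [cite: StacksProject, Tag 05GG] -/
theorem map_maximalIdeal_and_levelBijective_localCpl (C : Type u) [CommRing C] [IsLocalRing C]
    [IsNoetherianRing C] :
    (maximalIdeal C).map (algebraMap C (LocalCpl C)) = maximalIdeal (LocalCpl C) ∧
    ∀ n, Function.Bijective (Ideal.quotientMap (((maximalIdeal C) ^ n).map (algebraMap C (LocalCpl C)))
      (algebraMap C (LocalCpl C)) Ideal.le_comap_map) :=
  ⟨AdicCompletion.maximalIdeal_eq_map.symm, fun n => quotientMap_pow_bijective_adicCompletion (maximalIdeal C)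
    ((isNoetherianRing_iff_ideal_fg C).mp inferInstance _) n⟩

end Cpl

/-! ## From the chart comparison to the input of the engine -/

section LevelData

/-- **The level data of the fibre local ring at a point over the centre.** Let `ψ : A → 𝒪'` be a
local homomorphism of local rings (`𝒪'` Noetherian), `β : A → Λ` a ring map with `𝔪_A Λ = 𝔪_Λ`
which is residually onto (Cohen coordinates of the base), `T` a local ring of the chart
`R = Λ[x, y]/(xy - a₀)` at a prime `𝔔 ⊇ 𝔪_Λ R`, and `E : 𝒪̂' ≅ T̂` an isomorphism of completions
compatible with `ψ` and `(Λ → T) ∘ β` (the output of file 6 at a point `x'` over the centre). Let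
`l` be a copy of the residue field of `A` acting compatibly on the fibre ring
`B = 𝒪'/𝔪_A 𝒪'`. Then for the copy `ā ∈ l` of the residue of `a₀` there are a prime `𝔔_l` of the
model `l[x, y]/(xy - ā)` — containing `x̄` (resp. `ȳ`) iff `𝔔` does — and a ring map
`g₁ : B → Ĉ` into the completion of its local ring `C = (l[x, y]/(xy - ā))_{𝔔_l}`, compatible with
`l`, mapping `𝔪_B` onto `𝔪_Ĉ`, with bijective levels `B/𝔪_Bⁿ → Ĉ/𝔪ⁿ`: `g₁` is
`B → B̂ ≅ (T/𝔪_Λ T)^ ≅ Ĉ` (`exists_fibreCpl_equiv_of_localCpl_equiv`, file 4;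
`exists_chartFibre_equiv_localization_model`, file 11). Together with `C → Ĉ`
(`map_maximalIdeal_and_levelBijective_localCpl`) this is the input of the engine of file 9.
[cite: DeJong1996, 3.4 Claim (ii), p. 64] [cite: DeJong1997, proof of Prop. 5.11, p. 618] -/
theorem exists_levelData_of_chart {A Λ O' T : Type u} [CommRing A] [IsLocalRing A] [CommRing Λ]
    [IsLocalRing Λ] [CommRing O'] [IsLocalRing O'] [IsNoetherianRing O'] [CommRing T] [IsLocalRing T]
    [IsNoetherianRing T] (ψ : A →+* O') [IsLocalHom ψ] (β : A →+* Λ)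
    (hβM : (maximalIdeal A).map β = maximalIdeal Λ)
    (hβR : Function.Surjective ((Ideal.Quotient.mk (maximalIdeal Λ)).comp β))
    {a₀ : Λ} (𝔔 : Ideal (AlgebraicNodeRing Λ a₀)) [𝔔.IsPrime]
    [Algebra (AlgebraicNodeRing Λ a₀) T] [IsLocalization.AtPrime T 𝔔] [Algebra Λ T]
    [IsScalarTower Λ (AlgebraicNodeRing Λ a₀) T]
    (h𝔔Λ : (maximalIdeal Λ).map (algebraMap Λ (AlgebraicNodeRing Λ a₀)) ≤ 𝔔)
    (E : LocalCpl O' ≃+* LocalCpl T)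
    (hE : ∀ a, E (AdicCompletion.of _ _ (ψ a)) = AdicCompletion.of _ _ (algebraMap Λ T (β a)))
    (l : Type u) [Field l] [Algebra A l] (hl : Function.Surjective (algebraMap A l))
    (hlk : ∀ a, algebraMap A l a = 0 ↔ a ∈ maximalIdeal A)
    [Algebra l (O' ⧸ (maximalIdeal A).map ψ)]
    (hlB : ∀ a, algebraMap l (O' ⧸ (maximalIdeal A).map ψ) (algebraMap A l a) =
      Ideal.Quotient.mk _ (ψ a)) :
    ∃ (abar : l) (𝔔l : Ideal (AlgebraicNodeRing l abar)) (_ : 𝔔l.IsPrime)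
      (g₁ : (O' ⧸ (maximalIdeal A).map ψ) →+* LocalCpl (Localization.AtPrime 𝔔l)),
      (AlgebraicNodeRing.u l abar ∈ 𝔔l ↔ AlgebraicNodeRing.u Λ a₀ ∈ 𝔔) ∧
      (AlgebraicNodeRing.v l abar ∈ 𝔔l ↔ AlgebraicNodeRing.v Λ a₀ ∈ 𝔔) ∧
      (∀ c : l, g₁ (algebraMap l _ c) = algebraMap l (LocalCpl (Localization.AtPrime 𝔔l)) c) ∧
      ((maximalIdeal O').map (Ideal.Quotient.mk ((maximalIdeal A).map ψ))).map g₁ =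
        maximalIdeal (LocalCpl (Localization.AtPrime 𝔔l)) ∧
      (∀ n, Function.Bijective (Ideal.quotientMap
        (((((maximalIdeal O').map (Ideal.Quotient.mk ((maximalIdeal A).map ψ))) ^ n).map g₁)) g₁
        Ideal.le_comap_map)) := by
  classical
  -- the fibre ring `B = O'/𝔪_A O'` is local, with maximal ideal `𝔭 = 𝔪_{O'} B`
  have hJB : (maximalIdeal A).map ψ ≤ maximalIdeal O' := ((local_hom_TFAE ψ).out 0 2).mp ‹IsLocalHom ψ›
  have hJBne : (maximalIdeal A).map ψ ≠ ⊤ := fun h =>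
    (maximalIdeal.isMaximal O').ne_top (top_le_iff.mp (h ▸ hJB))
  haveI : Nontrivial (O' ⧸ (maximalIdeal A).map ψ) := Ideal.Quotient.nontrivial_iff.mpr hJBne
  haveI : IsLocalRing (O' ⧸ (maximalIdeal A).map ψ) :=
    IsLocalRing.of_surjective' (Ideal.Quotient.mk _) Ideal.Quotient.mk_surjective
  set 𝔭 : Ideal (O' ⧸ (maximalIdeal A).map ψ) :=
    (maximalIdeal O').map (Ideal.Quotient.mk ((maximalIdeal A).map ψ)) with h𝔭def
  have h𝔭 : 𝔭 = maximalIdeal (O' ⧸ (maximalIdeal A).map ψ) :=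
    IsLocalRing.map_maximalIdeal_of_surjective _ Ideal.Quotient.mk_surjective
  haveI h𝔭max : 𝔭.IsMaximal := h𝔭 ▸ maximalIdeal.isMaximal _
  have h𝔭fg : 𝔭.FG := (isNoetherianRing_iff_ideal_fg _).mp inferInstance 𝔭
  -- the completed fibre rings: `B̂ ≅ (T/𝔪_A T)^` (file 4)
  set θ : A →+* T := (algebraMap Λ T).comp β with hθ
  obtain ⟨E', hE'⟩ := exists_fibreCpl_equiv_of_localCpl_equiv ψ θ E hE
  -- `𝔪_A T = I T`, `I = 𝔪_Λ R`
  have hIT : (maximalIdeal A).map θ = (((maximalIdeal Λ).map (algebraMap Λ (AlgebraicNodeRing Λ a₀))).map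
      (algebraMap (AlgebraicNodeRing Λ a₀) T)) := by
    rw [hθ, ← Ideal.map_map, hβM, Ideal.map_map, ← IsScalarTower.algebraMap_eq]
  -- the residue field `l ≅ Λ/𝔪_Λ` and the chart fibre as a local ring of the model (file 11)
  obtain ⟨eκ, heκ⟩ := exists_ringEquiv_residueField_of_cohen l hl hlk β hβM hβR
  obtain ⟨𝔔l, h𝔔lp, ι, hu, hv, hι⟩ := exists_chartFibre_equiv_localization_model 𝔔 h𝔔Λ T l eκ
  -- `C₁ = T/𝔪_A T ≅ T/IT ≅ C₂ = (l[x,y]/(xy-ā))_{𝔔_l}`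
  let c₁ : (T ⧸ (maximalIdeal A).map θ) ≃+*
      (T ⧸ (((maximalIdeal Λ).map (algebraMap Λ (AlgebraicNodeRing Λ a₀))).map
        (algebraMap (AlgebraicNodeRing Λ a₀) T))) := Ideal.quotEquivOfEq hIT
  let ι' : (T ⧸ (maximalIdeal A).map θ) ≃+* Localization.AtPrime 𝔔l := c₁.trans ι
  haveI : IsLocalRing (T ⧸ (maximalIdeal A).map θ) := ι'.symm.isLocalRing
  obtain ⟨Eι, hEι⟩ := exists_localCpl_equiv_of_ringEquiv (R := T ⧸ (maximalIdeal A).map θ)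
    (S := Localization.AtPrime 𝔔l) ι'
  -- `(T/𝔪_A T)^` at `𝔪_T (T/𝔪_A T)` is the completion at the maximal ideal
  have hmC : ((maximalIdeal T).map (Ideal.Quotient.mk ((maximalIdeal A).map θ))).map
      (RingEquiv.refl (T ⧸ (maximalIdeal A).map θ)).toRingHom =
      localMaxIdeal (T ⧸ (maximalIdeal A).map θ) := by
    rw [IsLocalRing.map_maximalIdeal_of_surjective _ Ideal.Quotient.mk_surjective]
    exact Ideal.map_id _
  let congr₁ := adicCompletionCongr _ _ (RingEquiv.refl (T ⧸ (maximalIdeal A).map θ)) hmC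
  have hcongr₁ : ∀ x, congr₁ (AdicCompletion.of _ _ x) = AdicCompletion.of _ _ x := fun x =>
    adicCompletionCongr_of _ _ _ hmC x
  -- the composite `Φ : B̂ ≅ Ĉ₂` and `g₁ = Φ ∘ (B → B̂)`
  let Φ := (E'.trans congr₁).trans Eι
  let g₁ : (O' ⧸ (maximalIdeal A).map ψ) →+* LocalCpl (Localization.AtPrime 𝔔l) :=
    Φ.toRingHom.comp (algebraMap _ (AdicCompletion 𝔭 (O' ⧸ (maximalIdeal A).map ψ)))
  refine ⟨eκ.symm (residue Λ a₀), 𝔔l, h𝔔lp, g₁, hu, hv, fun c => ?_, ?_, fun n => ?_⟩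
  · -- compatibility with `l`
    obtain ⟨a, rfl⟩ := hl c
    have h1 : g₁ (algebraMap l _ (algebraMap A l a)) = Eι (congr₁ (E' (AdicCompletion.of _ _
        (Ideal.Quotient.mk _ (ψ a))))) := by
      rw [hlB]; rfl
    rw [h1, hE' a, hcongr₁, hEι, AdicCompletion.algebraMap_apply]
    congr 1
    change ι (c₁ (Ideal.Quotient.mk _ (θ a))) = _
    have h2 : c₁ (Ideal.Quotient.mk _ (θ a)) = Ideal.Quotient.mk _ (θ a) := Ideal.quotEquivOfEq_mk _ _
    rw [h2, hθ, RingHom.comp_apply, IsScalarTower.algebraMap_apply Λ (AlgebraicNodeRing Λ a₀) T, hι,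
      ← heκ, RingEquiv.symm_apply_apply]
  · -- `𝔪_B ↦ 𝔪_Ĉ`
    haveI hmax : (𝔭.map (algebraMap _ (AdicCompletion 𝔭 (O' ⧸ (maximalIdeal A).map ψ)))).IsMaximal :=
      AdicCompletion.isMaximal_map_of_le 𝔭 𝔭 le_rfl h𝔭fg
    have h1 : 𝔭.map g₁ = (𝔭.map (algebraMap _ (AdicCompletion 𝔭 (O' ⧸ (maximalIdeal A).map ψ)))).map
        Φ.toRingHom := (Ideal.map_map _ _).symm
    rw [h1]
    exact IsLocalRing.eq_maximalIdeal (Ideal.IsMaximal.map_bijective Φ.toRingHom Φ.bijective hmax)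
  · -- bijective levels
    exact (quotientMap_bijective_iff_of_ringEquiv (algebraMap _ (AdicCompletion 𝔭 (O' ⧸ (maximalIdeal A).map ψ)))
      Φ (𝔭 ^ n)).mpr (quotientMap_pow_bijective_adicCompletion 𝔭 h𝔭fg n)

end LevelData

end Summit.ResolutionOfSingularities.ResolutionOfSingularities.Theorems

end
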